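import Summits.QuantumFields.BalabanUV.T4Continuum.Support.VariationalCovariantBochner
import Summits.QuantumFields.BalabanUV.T4Continuum.Support.VariationalColourFederbush

/-!
# T⁴ programme, spine node NE2 (U1a), lane P2 — SUPPLIER ITEM (O8) «V-COL-REG»: THE COLOUR COVARIANT BOCHNER STEP for 0-forms with values in a Hilbert
# space `E` under UNITARY transport (commutators = plaquette defects in OPERATOR norm) — the colour re-run of `VariationalCovariantBochner.hessian_le` (p212484)

NE2 formalisation swarm, leaf prover 09 (gen 4); road owner t4-ne2-p2-g11's OPEN SUPPLIER ITEMS (CLAIMS.log l.10301) ∕ skeleton `t4/skeletons/NE2-t4-ne2-p2.md`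
v0.10 §2.E «V-COL = the COLOUR (adjoint ∕ matrix) re-run of §2.C's FED⁺ ∕ UB⁺ ∕ ONE⁺ ∕ P⁺ ∕ REG⁺ for M_o(ℂ)-valued 0-FORMS under `siteMul` transport by unitary matrices …
prerequisite of everything below» and row V-REG; this file is V-COL's REG⁺∕Bochner member (leaf-02-g4 holds the FED⁺ member `VariationalColourFederbush`).

THE STATEMENT (model level; ONE level; lattice units).  Fields `f : Tor N → E`, `E` any complex Hilbert space (`InnerProductSpace ℂ E`, complete);
transporters `R : Tor N → Fin d → (E →L[ℂ] E)` that are UNITARY (`R x μ ∈ unitary (E →L[ℂ] E)`, DATA) with PLAQUETTE DEFECT in operator norm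
`‖R(x,μ)∘R(x+e_μ,ν) − R(x,ν)∘R(x+e_ν,μ)‖ ≤ a` (DATA).  With `D_μ f (x) = R(x,μ) f(x+e_μ) − f(x)` (`Dirv`), its formal adjoint
`D_μ† g (x) = R(x−e_μ,μ)⋆ g(x−e_μ) − g(x)` (`DirAdjv`; `ipv g (D_μ† h) = ipv (D_μ g) h`), `D†D := Σ_μ D_μ†D_μ` (`negLapv`), and the EXACT commutators with
OPERATOR coefficients `[D_ν, D_μ] g (x) = (R(x,ν)∘R(x+e_ν,μ) − R(x,μ)∘R(x+e_μ,ν)) g(x+e_μ+e_ν)` (`Dirv_comm`) and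
`[D_ν, D_μ†] g (x) = (R(x,ν)∘R(x−e_μ+e_ν,μ)⋆ − R(x−e_μ,μ)⋆∘R(x−e_μ,ν)) g(x−e_μ+e_ν)` (`Dirv_DirAdjv_comm`, coefficient of norm `≤ a` by unitarity,
`norm_kappa1v_le`), one gets for EVERY field `f` (**`hessian_le`**):

  `Σ_{μ,ν} nsqv (D_μ D_ν f) ≤ 2·nsqv (D†D f) + 2ad·Σ_μ nsqv (D_μ f) + a²d²·nsqv f`,

and `directional_le` for `Σ_ν nsqv (D_ν†D_ν f)` (`nsqv_DirAdjv_eq`).  SAME constants as the U(1) leaf; NO commutativity is used anywhere (every `ring` step of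
p212484 is an order-preserving identity: `map_sub`∕`abel` on vectors, `star_mul_self`∕`mul_star_self` on unitaries).  Instances: `E = ℂ` with multiplication
operators by unit-modulus phases is the U(1) shape (remark); §4 `E = EuclideanSpace ℂ o` under UNITARY COLOUR MATRICES via Mathlib's ⋆-algebra equivalence
`Matrix.toEuclideanCLM` (leaf-02-g4's `toEuclideanCLM_mem_unitary` BY NAME, `matR`, `norm_matR_plaquette` — operator norm = matrix `L²`-operator norm) gives
**`hessian_le_matrix`** with the plaquette defect stated on the MATRICES — the owner's V-COL wording for the fundamental colour sector (matrix-valued fields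
under left multiplication = `o` copies of it); the identification of `U` with Bałaban's background or `ad U` is NOT asserted (c5).

HONEST FRAMING (T4-DAG p. 1).  Rung (B)+1 only — NOT infinite volume, NOT a mass gap, NOT Clay.  NE2 is NOT IN PRINT and NOT proved here.  MODEL LEVEL; OURS and
elementary ([folklore]: exact commutator identities + Cauchy–Schwarz∕AM–GM); nothing printed is a hypothesis; no `def … : Prop` fact; no `sorry`; axioms standard.
NOT here: REG⁺'s Euler–Lagrange half at the constrained minimiser (V-D ∕ V-REG proper), P⁺, any `k`, any NE3.  HONEST DEPENDENCY (cell, verbatim): continuum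
YM on T⁴ ⇐ BetaPertH ∧ nine spine estimates (0/9 proved); BetaPertH ⇐ (D1) ∧ (D4) ∧ CAP+tail; G-an2-4 gates asym, D1 and NE2/3/4.
-/

noncomputable section
namespace Summit.QuantumFields.BalabanUV.T4Continuum.VariationalColourBochner

open Finset
open scoped InnerProductSpace ComplexConjugate
open Literature.MathematicalPhysics.QuantumFieldTheory.Balaban1983to89.B5Prop11Plancherel (Tor unitVec)
open Summit.QuantumFields.BalabanUV.T4Continuum.VariationalCovariantBochner (mul_mul_le_half)
open Summit.QuantumFields.BalabanUV.T4Continuum.VariationalColourFederbush (cDv dirUv toEuclideanCLM_mem_unitary)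

variable {d : ℕ} (N : Fin d → ℕ) [∀ μ, NeZero (N μ)]
variable {E : Type*} [NormedAddCommGroup E] [InnerProductSpace ℂ E] [CompleteSpace E]

/-! ## §1 Carriers: covariant differences with operator transporters, adjoint, pairing -/

/-- `Σ_x ‖f x‖²` for an `E`-valued field. [folklore] -/
def nsqv (f : Tor N → E) : ℝ := ∑ x, ‖f x‖ ^ 2

omit [InnerProductSpace ℂ E] [CompleteSpace E] in
/-- `nsqv ≥ 0`. [folklore] -/
theorem nsqv_nonneg (f : Tor N → E) : 0 ≤ nsqv N f := sum_nonneg fun _ _ => by positivity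

/-- the covariant forward difference `(D_μ f)(x) = R(x,μ) f(x+e_μ) − f(x)` with OPERATOR transporters, as a field — leaf-02-g4's
`VariationalColourFederbush.cDv` read in direction `μ` (V-COL-FED's carrier, BY NAME; as the U(1) `VariationalCovariantBochner.Dir` reads `cD`). [folklore] -/
def Dirv (R : Tor N → Fin d → (E →L[ℂ] E)) (μ : Fin d) (f : Tor N → E) : Tor N → E := fun x => cDv N R f x μ

omit [∀ μ, NeZero (N μ)] [CompleteSpace E] in
/-- `Dirv` unfolds to leaf-02-g4's `VariationalColourFederbush.cDv` (V-COL-FED's carrier, BY NAME). [folklore] -/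
theorem Dirv_apply (R : Tor N → Fin d → (E →L[ℂ] E)) (μ : Fin d) (f : Tor N → E) (x : Tor N) :
    Dirv N R μ f x = R x μ (f (x + unitVec N μ)) - f x := rfl

/-- the formal adjoint `(D_μ† g)(x) = R(x−e_μ,μ)⋆ g(x−e_μ) − g(x)`. [folklore] -/
def DirAdjv (R : Tor N → Fin d → (E →L[ℂ] E)) (μ : Fin d) (g : Tor N → E) : Tor N → E :=
  fun x => star (R (x - unitVec N μ) μ) (g (x - unitVec N μ)) - g x

/-- the covariant (negative) Laplacian `D†D f = Σ_μ D_μ† D_μ f`. [folklore] -/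
def negLapv (R : Tor N → Fin d → (E →L[ℂ] E)) (f : Tor N → E) : Tor N → E :=
  fun x => ∑ μ, DirAdjv N R μ (Dirv N R μ f) x

/-- the `ℓ²` pairing `Σ_x ⟪g x, f x⟫`. [folklore] -/
def ipv (g f : Tor N → E) : ℂ := ∑ x, ⟪g x, f x⟫_ℂ

omit [CompleteSpace E] in
/-- `ipv f f = nsqv f`. [folklore] -/
theorem ipv_self (f : Tor N → E) : ipv N f f = ((nsqv N f : ℝ) : ℂ) := by
  unfold ipv nsqv; push_cast; exact sum_congr rfl fun x _ => inner_self_eq_norm_sq_to_K (𝕜 := ℂ) (f x)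

omit [CompleteSpace E] in
/-- Hermitian symmetry of the pairing. [folklore] -/
theorem conj_ipv (g f : Tor N → E) : conj (ipv N g f) = ipv N f g := by
  unfold ipv; rw [map_sum]
  exact sum_congr rfl fun x _ => inner_conj_symm _ _

omit [CompleteSpace E] in
/-- additivity of the pairing in the second slot over a finite sum of fields. [folklore] -/
theorem ipv_sum_right {ι : Type*} (s : Finset ι) (g : Tor N → E) (F : ι → Tor N → E) :
    ipv N g (fun x => ∑ i ∈ s, F i x) = ∑ i ∈ s, ipv N g (F i) := by
  unfold ipv; rw [sum_comm]
  exact sum_congr rfl fun x _ => inner_sum _ _ _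

omit [CompleteSpace E] in
/-- `‖ipv g f‖ ≤ Σ_x ‖g x‖·‖f x‖`. [folklore] -/
theorem norm_ipv_le (g f : Tor N → E) : ‖ipv N g f‖ ≤ ∑ x, ‖g x‖ * ‖f x‖ := by
  unfold ipv
  exact (norm_sum_le _ _).trans (sum_le_sum fun x _ => norm_inner_le_norm _ _)

omit [∀ μ, NeZero (N μ)] in
/-- `⟪v, U⋆ w⟫ = ⟪U v, w⟫`. [folklore] -/
theorem inner_star_apply (U : E →L[ℂ] E) (v w : E) : ⟪v, (star U) w⟫_ℂ = ⟪U v, w⟫_ℂ := by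
  rw [ContinuousLinearMap.star_eq_adjoint]; exact ContinuousLinearMap.adjoint_inner_right U v w

/-- **ADJOINTNESS** (exact, torus): `ipv g (D_μ† h) = ipv (D_μ g) h`. [folklore] -/
theorem ipv_DirAdjv (R : Tor N → Fin d → (E →L[ℂ] E)) (μ : Fin d) (g h : Tor N → E) :
    ipv N g (DirAdjv N R μ h) = ipv N (Dirv N R μ g) h := by
  unfold ipv DirAdjv Dirv cDv
  simp_rw [inner_sub_right, inner_sub_left, sum_sub_distrib]
  have htr : ∑ x, ⟪g x, (star (R (x - unitVec N μ) μ)) (h (x - unitVec N μ))⟫_ℂ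
      = ∑ x, ⟪g (x + unitVec N μ), (star (R x μ)) (h x)⟫_ℂ := by
    rw [← Equiv.sum_comp (Equiv.addRight (unitVec N μ))]
    exact sum_congr rfl fun x _ => by simp [add_sub_cancel_right]
  rw [htr]
  exact congrArg₂ _ (sum_congr rfl fun x _ => inner_star_apply _ _ _) rfl

omit [∀ μ, NeZero (N μ)] [CompleteSpace E] in
/-- `D_ν` is additive over finite sums of fields. [folklore] -/
theorem Dirv_sum {ι : Type*} (R : Tor N → Fin d → (E →L[ℂ] E)) (ν : Fin d) (s : Finset ι) (F : ι → Tor N → E) (x : Tor N) :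
    Dirv N R ν (fun y => ∑ i ∈ s, F i y) x = ∑ i ∈ s, Dirv N R ν (F i) x := by
  simp only [Dirv, cDv, map_sum, ← sum_sub_distrib]

omit [∀ μ, NeZero (N μ)] in
/-- `D_μ†` of a difference of fields. [folklore] -/
theorem DirAdjv_sub (R : Tor N → Fin d → (E →L[ℂ] E)) (μ : Fin d) (F G : Tor N → E) (x : Tor N) :
    DirAdjv N R μ (fun y => F y - G y) x = DirAdjv N R μ F x - DirAdjv N R μ G x := by
  simp only [DirAdjv, map_sub]; abel

/-! ## §2 The two exact commutators with operator coefficients (curvature enters only here) -/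

omit [∀ μ, NeZero (N μ)] [CompleteSpace E] in
/-- **`[D_ν, D_μ] g (x) = (R(x,ν)∘R(x+e_ν,μ) − R(x,μ)∘R(x+e_μ,ν)) g(x+e_μ+e_ν)`** — the plaquette holonomy defect as an OPERATOR. [folklore] -/
theorem Dirv_comm (R : Tor N → Fin d → (E →L[ℂ] E)) (μ ν : Fin d) (g : Tor N → E) (x : Tor N) :
    Dirv N R ν (Dirv N R μ g) x - Dirv N R μ (Dirv N R ν g) x
      = (R x ν * R (x + unitVec N ν) μ - R x μ * R (x + unitVec N μ) ν) (g (x + unitVec N μ + unitVec N ν)) := by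
  simp only [Dirv, cDv, map_sub, sub_apply, mul_apply_eq_comp]
  rw [add_right_comm x (unitVec N ν) (unitVec N μ)]
  abel

omit [∀ μ, NeZero (N μ)] in
/-- **`[D_ν, D_μ†] g (x) = κ₁(x) g(x−e_μ+e_ν)`**, `κ₁(x) = R(x,ν)∘R(x−e_μ+e_ν,μ)⋆ − R(x−e_μ,μ)⋆∘R(x−e_μ,ν)`. [folklore] -/
theorem Dirv_DirAdjv_comm (R : Tor N → Fin d → (E →L[ℂ] E)) (μ ν : Fin d) (g : Tor N → E) (x : Tor N) :
    Dirv N R ν (DirAdjv N R μ g) x - DirAdjv N R μ (Dirv N R ν g) x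
      = (R x ν * star (R (x - unitVec N μ + unitVec N ν) μ) - star (R (x - unitVec N μ) μ) * R (x - unitVec N μ) ν)
          (g (x - unitVec N μ + unitVec N ν)) := by
  simp only [Dirv, DirAdjv, cDv, map_sub, sub_apply, mul_apply_eq_comp]
  rw [add_sub_right_comm x (unitVec N ν) (unitVec N μ)]
  abel

omit [∀ μ, NeZero (N μ)] in
/-- a unitary has operator norm `≤ 1` (`= 1` unless `E = 0`). [folklore] -/
theorem opNorm_le_one_of_mem_unitary {U : E →L[ℂ] E} (hU : U ∈ unitary (E →L[ℂ] E)) : ‖U‖ ≤ 1 :=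
  ContinuousLinearMap.opNorm_le_bound _ zero_le_one fun v => by rw [ContinuousLinearMap.norm_map_of_mem_unitary hU, one_mul]

omit [∀ μ, NeZero (N μ)] in
/-- for UNITARY transporters `‖κ₁(x)‖ ≤ a`, the plaquette defect at `x − e_μ` (`κ₁ = R⋆ ∘ [plaquette defect] ∘ R⋆`). [folklore] -/
theorem norm_kappa1v_le {R : Tor N → Fin d → (E →L[ℂ] E)} (hU : ∀ x μ, R x μ ∈ unitary (E →L[ℂ] E)) {a : ℝ}
    (hP : ∀ x μ ν, ‖R x μ * R (x + unitVec N μ) ν - R x ν * R (x + unitVec N ν) μ‖ ≤ a) (μ ν : Fin d) (x : Tor N) :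
    ‖R x ν * star (R (x - unitVec N μ + unitVec N ν) μ) - star (R (x - unitVec N μ) μ) * R (x - unitVec N μ) ν‖ ≤ a := by
  set y := x - unitVec N μ with hy
  have hx : y + unitVec N μ = x := by rw [hy, sub_add_cancel]
  have u1 : star (R y μ) * R y μ = 1 := Unitary.star_mul_self_of_mem (hU y μ)
  have u2 : R (y + unitVec N ν) μ * star (R (y + unitVec N ν) μ) = 1 := Unitary.mul_star_self_of_mem (hU _ μ)
  have key : star (R y μ) * (R y μ * R x ν - R y ν * R (y + unitVec N ν) μ) * star (R (y + unitVec N ν) μ)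
      = R x ν * star (R (y + unitVec N ν) μ) - star (R y μ) * R y ν := by
    have e : star (R y μ) * (R y μ * R x ν - R y ν * R (y + unitVec N ν) μ) * star (R (y + unitVec N ν) μ)
        = (star (R y μ) * R y μ) * R x ν * star (R (y + unitVec N ν) μ)
          - star (R y μ) * R y ν * (R (y + unitVec N ν) μ * star (R (y + unitVec N ν) μ)) := by noncomm_ring
    rw [e, u1, u2, one_mul, mul_one]
  have ha := hP y μ ν
  rw [hx] at ha
  calc ‖R x ν * star (R (y + unitVec N ν) μ) - star (R y μ) * R y ν‖
      = ‖star (R y μ) * (R y μ * R x ν - R y ν * R (y + unitVec N ν) μ) * star (R (y + unitVec N ν) μ)‖ := by rw [key]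
    _ ≤ ‖star (R y μ)‖ * ‖R y μ * R x ν - R y ν * R (y + unitVec N ν) μ‖ * ‖star (R (y + unitVec N ν) μ)‖ :=
        (norm_mul_le _ _).trans (mul_le_mul_of_nonneg_right (norm_mul_le _ _) (norm_nonneg _))
    _ ≤ 1 * a * 1 := by
        have h1 : ‖star (R y μ)‖ ≤ 1 := by rw [norm_star]; exact opNorm_le_one_of_mem_unitary (hU y μ)
        have h2 : ‖star (R (y + unitVec N ν) μ)‖ ≤ 1 := by rw [norm_star]; exact opNorm_le_one_of_mem_unitary (hU _ μ)
        have h0 : 0 ≤ a := (norm_nonneg _).trans ha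
        exact mul_le_mul (mul_le_mul h1 ha (norm_nonneg _) zero_le_one) h2 (norm_nonneg _) (by positivity)
    _ = a := by ring

/-! ## §3 The two sides as sums of pairings, and the Bochner estimate -/

/-- `Σ_{μ,ν} nsqv (D_μD_ν f) = Σ_{μ,ν} ipv (D_ν f) (D_μ†D_μD_ν f)`. [folklore] -/
theorem hessian_eq_sum_ipv (R : Tor N → Fin d → (E →L[ℂ] E)) (f : Tor N → E) :
    ((∑ μ, ∑ ν, nsqv N (Dirv N R μ (Dirv N R ν f)) : ℝ) : ℂ)
      = ∑ μ, ∑ ν, ipv N (Dirv N R ν f) (DirAdjv N R μ (Dirv N R μ (Dirv N R ν f))) := by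
  push_cast
  refine sum_congr rfl fun μ _ => sum_congr rfl fun ν _ => ?_
  rw [ipv_DirAdjv, ipv_self]

/-- `nsqv (D†D f) = Σ_{μ,ν} ipv (D_ν f) (D_ν D_μ†D_μ f)` (the total is real, so it equals its conjugate). [folklore] -/
theorem nsqv_negLapv_eq_sum_ipv (R : Tor N → Fin d → (E →L[ℂ] E)) (f : Tor N → E) :
    ((nsqv N (negLapv N R f) : ℝ) : ℂ) = ∑ μ, ∑ ν, ipv N (Dirv N R ν f) (Dirv N R ν (DirAdjv N R μ (Dirv N R μ f))) := by
  have h1 : ((nsqv N (negLapv N R f) : ℝ) : ℂ) = ∑ ν, ipv N (negLapv N R f) (DirAdjv N R ν (Dirv N R ν f)) := by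
    rw [← ipv_self, ← ipv_sum_right]; rfl
  have h2 : ∀ ν, ipv N (negLapv N R f) (DirAdjv N R ν (Dirv N R ν f))
      = ∑ μ, ipv N (Dirv N R ν (DirAdjv N R μ (Dirv N R μ f))) (Dirv N R ν f) := by
    intro ν
    rw [ipv_DirAdjv]
    have : Dirv N R ν (negLapv N R f) = fun x => ∑ μ, Dirv N R ν (DirAdjv N R μ (Dirv N R μ f)) x := by
      funext x; rw [← Dirv_sum]; rfl
    rw [this]
    unfold ipv
    rw [sum_comm]
    exact sum_congr rfl fun x _ => sum_inner _ _ _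
  have h3 : ((nsqv N (negLapv N R f) : ℝ) : ℂ) = ∑ μ, ∑ ν, ipv N (Dirv N R ν (DirAdjv N R μ (Dirv N R μ f))) (Dirv N R ν f) := by
    rw [h1]; simp_rw [h2]; rw [sum_comm]
  calc ((nsqv N (negLapv N R f) : ℝ) : ℂ) = conj (((nsqv N (negLapv N R f) : ℝ) : ℂ)) := (Complex.conj_ofReal _).symm
    _ = ∑ μ, ∑ ν, ipv N (Dirv N R ν f) (Dirv N R ν (DirAdjv N R μ (Dirv N R μ f))) := by
        rw [h3, map_sum]
        refine sum_congr rfl fun μ _ => ?_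
        rw [map_sum]
        exact sum_congr rfl fun ν _ => conj_ipv N _ _

omit [∀ μ, NeZero (N μ)] in
/-- the operator identity behind Bochner: `D_ν D_μ†D_μ g − D_μ†D_μ D_ν g = [D_ν,D_μ†](D_μ g) + D_μ†([D_ν,D_μ] g)`, pointwise. [folklore] -/
theorem bochner_split (R : Tor N → Fin d → (E →L[ℂ] E)) (μ ν : Fin d) (g : Tor N → E) (x : Tor N) :
    Dirv N R ν (DirAdjv N R μ (Dirv N R μ g)) x - DirAdjv N R μ (Dirv N R μ (Dirv N R ν g)) x
      = (Dirv N R ν (DirAdjv N R μ (Dirv N R μ g)) x - DirAdjv N R μ (Dirv N R ν (Dirv N R μ g)) x)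
        + DirAdjv N R μ (fun y => Dirv N R ν (Dirv N R μ g) y - Dirv N R μ (Dirv N R ν g) y) x := by
  rw [DirAdjv_sub]; abel

omit [InnerProductSpace ℂ E] [CompleteSpace E] in
/-- translation invariance of `nsqv`-type sums. [folklore] -/
theorem sum_sq_translate (g : Tor N → E) (v : Tor N) : ∑ x, ‖g (x + v)‖ ^ 2 = ∑ x, ‖g x‖ ^ 2 :=
  Equiv.sum_comp (Equiv.addRight v) (fun x => ‖g x‖ ^ 2)

/-- the curvature error of the `(μ,ν)` term: `≤ (a/2)(nsqv D_ν f + nsqv D_μ f) + ½ nsqv (D_μD_ν f) + (a²/2) nsqv f`. [folklore] -/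
theorem error_term_le {R : Tor N → Fin d → (E →L[ℂ] E)} (hU : ∀ x μ, R x μ ∈ unitary (E →L[ℂ] E)) {a : ℝ} (ha : 0 ≤ a)
    (hP : ∀ x μ ν, ‖R x μ * R (x + unitVec N μ) ν - R x ν * R (x + unitVec N ν) μ‖ ≤ a) (μ ν : Fin d) (f : Tor N → E) :
    ‖ipv N (Dirv N R ν f) (fun x => Dirv N R ν (DirAdjv N R μ (Dirv N R μ f)) x - DirAdjv N R μ (Dirv N R ν (Dirv N R μ f)) x)
        + ipv N (Dirv N R μ (Dirv N R ν f)) (fun y => Dirv N R ν (Dirv N R μ f) y - Dirv N R μ (Dirv N R ν f) y)‖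
      ≤ a / 2 * (nsqv N (Dirv N R ν f) + nsqv N (Dirv N R μ f)) + nsqv N (Dirv N R μ (Dirv N R ν f)) / 2 + a ^ 2 / 2 * nsqv N f := by
  refine (norm_add_le _ _).trans ?_
  -- first pairing: the commutator `[D_ν, D_μ†]` applied to `D_μ f`
  have e1 : ‖ipv N (Dirv N R ν f) (fun x => Dirv N R ν (DirAdjv N R μ (Dirv N R μ f)) x - DirAdjv N R μ (Dirv N R ν (Dirv N R μ f)) x)‖
      ≤ a / 2 * (nsqv N (Dirv N R ν f) + nsqv N (Dirv N R μ f)) := by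
    refine (norm_ipv_le N _ _).trans ?_
    have hpt : ∀ x, ‖Dirv N R ν f x‖ * ‖Dirv N R ν (DirAdjv N R μ (Dirv N R μ f)) x - DirAdjv N R μ (Dirv N R ν (Dirv N R μ f)) x‖
        ≤ (a * ‖Dirv N R ν f x‖ ^ 2 + a * ‖Dirv N R μ f (x - unitVec N μ + unitVec N ν)‖ ^ 2) / 2 := by
      intro x
      rw [Dirv_DirAdjv_comm]
      have hk := norm_kappa1v_le N hU hP μ ν x
      calc ‖Dirv N R ν f x‖ * ‖(R x ν * star (R (x - unitVec N μ + unitVec N ν) μ) - star (R (x - unitVec N μ) μ) * R (x - unitVec N μ) ν)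
              (Dirv N R μ f (x - unitVec N μ + unitVec N ν))‖
          ≤ ‖Dirv N R ν f x‖ * (a * ‖Dirv N R μ f (x - unitVec N μ + unitVec N ν)‖) :=
            mul_le_mul_of_nonneg_left ((ContinuousLinearMap.le_opNorm _ _).trans
              (mul_le_mul_of_nonneg_right hk (norm_nonneg _))) (norm_nonneg _)
        _ ≤ _ := (mul_mul_le_half _ _ ha).1
    refine (sum_le_sum fun x _ => hpt x).trans (le_of_eq ?_)
    rw [← sum_div, sum_add_distrib, ← mul_sum, ← mul_sum]
    have htr : ∑ x, ‖Dirv N R μ f (x - unitVec N μ + unitVec N ν)‖ ^ 2 = nsqv N (Dirv N R μ f) := by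
      have := sum_sq_translate N (Dirv N R μ f) (-unitVec N μ + unitVec N ν)
      unfold nsqv; rw [← this]
      exact sum_congr rfl fun x _ => by rw [← add_assoc, ← sub_eq_add_neg]
    rw [htr]; unfold nsqv; ring
  -- second pairing: the commutator `[D_ν, D_μ]` applied to `f`
  have e2 : ‖ipv N (Dirv N R μ (Dirv N R ν f)) (fun y => Dirv N R ν (Dirv N R μ f) y - Dirv N R μ (Dirv N R ν f) y)‖
      ≤ nsqv N (Dirv N R μ (Dirv N R ν f)) / 2 + a ^ 2 / 2 * nsqv N f := by
    refine (norm_ipv_le N _ _).trans ?_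
    have hpt : ∀ x, ‖Dirv N R μ (Dirv N R ν f) x‖ * ‖Dirv N R ν (Dirv N R μ f) x - Dirv N R μ (Dirv N R ν f) x‖
        ≤ (‖Dirv N R μ (Dirv N R ν f) x‖ ^ 2 + a ^ 2 * ‖f (x + unitVec N μ + unitVec N ν)‖ ^ 2) / 2 := by
      intro x
      rw [Dirv_comm]
      have hk : ‖R x ν * R (x + unitVec N ν) μ - R x μ * R (x + unitVec N μ) ν‖ ≤ a := by rw [norm_sub_rev]; exact hP x μ ν
      calc ‖Dirv N R μ (Dirv N R ν f) x‖ * ‖(R x ν * R (x + unitVec N ν) μ - R x μ * R (x + unitVec N μ) ν) (f (x + unitVec N μ + unitVec N ν))‖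
          ≤ ‖Dirv N R μ (Dirv N R ν f) x‖ * (a * ‖f (x + unitVec N μ + unitVec N ν)‖) :=
            mul_le_mul_of_nonneg_left ((ContinuousLinearMap.le_opNorm _ _).trans
              (mul_le_mul_of_nonneg_right hk (norm_nonneg _))) (norm_nonneg _)
        _ ≤ _ := (mul_mul_le_half _ _ ha).2
    refine (sum_le_sum fun x _ => hpt x).trans (le_of_eq ?_)
    rw [← sum_div, sum_add_distrib, ← mul_sum]
    have htr : ∑ x, ‖f (x + unitVec N μ + unitVec N ν)‖ ^ 2 = nsqv N f := by
      have := sum_sq_translate N f (unitVec N μ + unitVec N ν)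
      unfold nsqv; rw [← this]
      exact sum_congr rfl fun x _ => by rw [add_assoc]
    rw [htr]; unfold nsqv; ring
  linarith

/-- **THE COVARIANT BOCHNER ESTIMATE (0-forms, Hilbert-space values, UNITARY transporters)**: with plaquette defect `≤ a` in operator norm, for EVERY
field `f`: `Σ_{μ,ν} nsqv (D_μD_ν f) ≤ 2·nsqv (D†D f) + 2ad·Σ_μ nsqv (D_μ f) + a²d²·nsqv f` (constants of the U(1) leaf; no commutativity). [folklore] -/
theorem hessian_le {R : Tor N → Fin d → (E →L[ℂ] E)} (hU : ∀ x μ, R x μ ∈ unitary (E →L[ℂ] E)) {a : ℝ} (ha : 0 ≤ a)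
    (hP : ∀ x μ ν, ‖R x μ * R (x + unitVec N μ) ν - R x ν * R (x + unitVec N ν) μ‖ ≤ a) (f : Tor N → E) :
    ∑ μ, ∑ ν, nsqv N (Dirv N R μ (Dirv N R ν f))
      ≤ 2 * nsqv N (negLapv N R f) + 2 * a * d * ∑ μ, nsqv N (Dirv N R μ f) + a ^ 2 * d ^ 2 * nsqv N f := by
  set H : ℝ := ∑ μ, ∑ ν, nsqv N (Dirv N R μ (Dirv N R ν f)) with hH
  set L : ℝ := nsqv N (negLapv N R f) with hL
  set Er : Fin d → Fin d → ℂ := fun μ ν =>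
    ipv N (Dirv N R ν f) (fun x => Dirv N R ν (DirAdjv N R μ (Dirv N R μ f)) x - DirAdjv N R μ (Dirv N R ν (Dirv N R μ f)) x)
      + ipv N (Dirv N R μ (Dirv N R ν f)) (fun y => Dirv N R ν (Dirv N R μ f) y - Dirv N R μ (Dirv N R ν f) y) with hEr
  have hdiff : ((L : ℝ) : ℂ) - ((H : ℝ) : ℂ) = ∑ μ, ∑ ν, Er μ ν := by
    rw [hL, hH, nsqv_negLapv_eq_sum_ipv, hessian_eq_sum_ipv, ← sum_sub_distrib]
    refine sum_congr rfl fun μ _ => ?_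
    rw [← sum_sub_distrib]
    refine sum_congr rfl fun ν _ => ?_
    have hsplit : ipv N (Dirv N R ν f) (Dirv N R ν (DirAdjv N R μ (Dirv N R μ f))) - ipv N (Dirv N R ν f) (DirAdjv N R μ (Dirv N R μ (Dirv N R ν f)))
        = ipv N (Dirv N R ν f) (fun x => Dirv N R ν (DirAdjv N R μ (Dirv N R μ f)) x - DirAdjv N R μ (Dirv N R ν (Dirv N R μ f)) x)
          + ipv N (Dirv N R ν f) (DirAdjv N R μ (fun y => Dirv N R ν (Dirv N R μ f) y - Dirv N R μ (Dirv N R ν f) y)) := by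
      unfold ipv
      rw [← sum_sub_distrib, ← sum_add_distrib]
      refine sum_congr rfl fun x _ => ?_
      rw [← inner_sub_right, ← inner_add_right, bochner_split]
    rw [hsplit, hEr, ipv_DirAdjv]
  have hEle : ∀ μ ν, ‖Er μ ν‖ ≤ a / 2 * (nsqv N (Dirv N R ν f) + nsqv N (Dirv N R μ f)) + nsqv N (Dirv N R μ (Dirv N R ν f)) / 2
      + a ^ 2 / 2 * nsqv N f :=
    fun μ ν => error_term_le N hU ha hP μ ν f
  have hsumE : ‖∑ μ, ∑ ν, Er μ ν‖ ≤ a * d * ∑ μ, nsqv N (Dirv N R μ f) + H / 2 + a ^ 2 * d ^ 2 / 2 * nsqv N f := by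
    calc ‖∑ μ, ∑ ν, Er μ ν‖ ≤ ∑ μ, ∑ ν, ‖Er μ ν‖ := (norm_sum_le _ _).trans (sum_le_sum fun μ _ => norm_sum_le _ _)
      _ ≤ ∑ μ, ∑ ν, (a / 2 * (nsqv N (Dirv N R ν f) + nsqv N (Dirv N R μ f)) + nsqv N (Dirv N R μ (Dirv N R ν f)) / 2
          + a ^ 2 / 2 * nsqv N f) :=
          sum_le_sum fun μ _ => sum_le_sum fun ν _ => hEle μ ν
      _ = a * d * ∑ μ, nsqv N (Dirv N R μ f) + H / 2 + a ^ 2 * d ^ 2 / 2 * nsqv N f := by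
          simp only [sum_add_distrib, mul_add, ← mul_sum, ← sum_div, sum_const, card_univ, Fintype.card_fin, nsmul_eq_mul]
          ring
  have hre : L - H = (∑ μ, ∑ ν, Er μ ν).re := by
    have h := congrArg Complex.re hdiff
    simp only [Complex.sub_re, Complex.ofReal_re] at h
    exact h
  have habs : H - L ≤ ‖∑ μ, ∑ ν, Er μ ν‖ := by
    have h := Complex.abs_re_le_norm (∑ μ, ∑ ν, Er μ ν)
    rw [← hre] at h
    linarith [(abs_le.mp h).1]
  linarith

/-- for UNITARY transporters `‖D_ν† g‖² = ‖D_ν g‖²` (a transported, translated forward difference). [folklore] -/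
theorem nsqv_DirAdjv_eq {R : Tor N → Fin d → (E →L[ℂ] E)} (hU : ∀ x μ, R x μ ∈ unitary (E →L[ℂ] E)) (ν : Fin d) (g : Tor N → E) :
    nsqv N (DirAdjv N R ν g) = nsqv N (Dirv N R ν g) := by
  have hpt : ∀ x, ‖DirAdjv N R ν g x‖ = ‖Dirv N R ν g (x - unitVec N ν)‖ := by
    intro x
    have u : star (R (x - unitVec N ν) ν) * R (x - unitVec N ν) ν = 1 := Unitary.star_mul_self_of_mem (hU _ ν)
    have e : DirAdjv N R ν g x = -((star (R (x - unitVec N ν) ν)) (Dirv N R ν g (x - unitVec N ν))) := by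
      have h1 : (star (R (x - unitVec N ν) ν)) ((R (x - unitVec N ν) ν) (g x)) = g x := by
        rw [← mul_apply_eq_comp, u, one_apply_eq_self]
      simp only [DirAdjv, Dirv, cDv, sub_add_cancel, map_sub, h1]
      abel
    rw [e, norm_neg, ContinuousLinearMap.norm_map_of_mem_unitary (Unitary.star_mem (hU _ ν))]
  unfold nsqv
  simp_rw [hpt]
  have := sum_sq_translate N (Dirv N R ν g) (-unitVec N ν)
  simp_rw [← sub_eq_add_neg] at this
  exact this

/-- **DIRECTIONAL FORM**: `Σ_ν nsqv (D_ν†D_ν f) ≤ 2·nsqv (D†D f) + 2ad·Σ_μ nsqv (D_μ f) + a²d²·nsqv f`. [folklore] -/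
theorem directional_le {R : Tor N → Fin d → (E →L[ℂ] E)} (hU : ∀ x μ, R x μ ∈ unitary (E →L[ℂ] E)) {a : ℝ} (ha : 0 ≤ a)
    (hP : ∀ x μ ν, ‖R x μ * R (x + unitVec N μ) ν - R x ν * R (x + unitVec N ν) μ‖ ≤ a) (f : Tor N → E) :
    ∑ ν, nsqv N (DirAdjv N R ν (Dirv N R ν f))
      ≤ 2 * nsqv N (negLapv N R f) + 2 * a * d * ∑ μ, nsqv N (Dirv N R μ f) + a ^ 2 * d ^ 2 * nsqv N f := by
  refine le_trans ?_ (hessian_le N hU ha hP f)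
  calc ∑ ν, nsqv N (DirAdjv N R ν (Dirv N R ν f)) = ∑ ν, nsqv N (Dirv N R ν (Dirv N R ν f)) :=
        sum_congr rfl fun ν _ => nsqv_DirAdjv_eq N hU ν _
    _ ≤ ∑ μ, ∑ ν, nsqv N (Dirv N R μ (Dirv N R ν f)) :=
        sum_le_sum fun μ _ => single_le_sum (f := fun ν => nsqv N (Dirv N R μ (Dirv N R ν f))) (fun ν _ => nsqv_nonneg N _) (mem_univ μ)

omit [CompleteSpace E] in
/-- the directional Dirichlet sums of V-COL-FED's carriers: `Σ_μ nsqv (Dirv μ f) = Σ_μ dirUv R f μ` (leaf-02-g4's `dirUv`, BY NAME). [folklore] -/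
theorem sum_nsqv_Dirv_eq (R : Tor N → Fin d → (E →L[ℂ] E)) (f : Tor N → E) : ∑ μ, nsqv N (Dirv N R μ f) = ∑ μ, dirUv N R f μ := rfl

/-! ## §4 The owner's V-COL wording: UNITARY COLOUR MATRICES acting on `EuclideanSpace ℂ o` (fundamental colour) -/

section ColourMatrices

open scoped Matrix.Norms.L2Operator

variable {o : Type*} [Fintype o] [DecidableEq o]

/-- the transporters of a field of colour matrices, as operators on `EuclideanSpace ℂ o`. [folklore] -/
def matR (U : Tor N → Fin d → Matrix o o ℂ) : Tor N → Fin d → (EuclideanSpace ℂ o →L[ℂ] EuclideanSpace ℂ o) :=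
  fun x μ => Matrix.toEuclideanCLM (n := o) (𝕜 := ℂ) (U x μ)

omit [∀ μ, NeZero (N μ)] in
/-- the plaquette defect of `matR U` in operator norm IS the matrix plaquette defect in the `L²`-operator norm. [folklore] -/
theorem norm_matR_plaquette (U : Tor N → Fin d → Matrix o o ℂ) (x : Tor N) (μ ν : Fin d) :
    ‖matR N U x μ * matR N U (x + unitVec N μ) ν - matR N U x ν * matR N U (x + unitVec N ν) μ‖
      = ‖U x μ * U (x + unitVec N μ) ν - U x ν * U (x + unitVec N ν) μ‖ := by
  simp only [matR, ← map_mul, ← map_sub, Matrix.l2_opNorm_toEuclideanCLM]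

/-- **THE COVARIANT BOCHNER ESTIMATE FOR THE FUNDAMENTAL COLOUR SECTOR**: `ℂ^o`-valued 0-forms transported by UNITARY colour matrices with
plaquette defect `‖U(x,μ)U(x+e_μ,ν) − U(x,ν)U(x+e_ν,μ)‖_{2→2} ≤ a`: the same inequality with the same constants. [folklore] -/
theorem hessian_le_matrix {U : Tor N → Fin d → Matrix o o ℂ} (hU : ∀ x μ, U x μ ∈ Matrix.unitaryGroup o ℂ) {a : ℝ} (ha : 0 ≤ a)
    (hP : ∀ x μ ν, ‖U x μ * U (x + unitVec N μ) ν - U x ν * U (x + unitVec N ν) μ‖ ≤ a) (f : Tor N → EuclideanSpace ℂ o) :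
    ∑ μ, ∑ ν, nsqv N (Dirv N (matR N U) μ (Dirv N (matR N U) ν f))
      ≤ 2 * nsqv N (negLapv N (matR N U) f) + 2 * a * d * ∑ μ, nsqv N (Dirv N (matR N U) μ f) + a ^ 2 * d ^ 2 * nsqv N f := by
  have hP' : ∀ x μ ν, ‖matR N U x μ * matR N U (x + unitVec N μ) ν - matR N U x ν * matR N U (x + unitVec N ν) μ‖ ≤ a :=
    fun x μ ν => by rw [norm_matR_plaquette]; exact hP x μ ν
  exact hessian_le N (R := matR N U) (fun x μ => toEuclideanCLM_mem_unitary (hU x μ)) ha hP' f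

end ColourMatrices

end Summit.QuantumFields.BalabanUV.T4Continuum.VariationalColourBochner

end
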